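import Mathlib.NumberTheory.NumberField.InfinitePlace.Ramification
import Mathlib.NumberTheory.NumberField.Basic
import Mathlib.RingTheory.Ideal.Norm.AbsNorm
import Literature.NumberTheory.NumberFields.ArithmeticEquivalence
import HarnessLib

/-!
# Norms of primes and multiplicities of archimedean places are preserved along a ring isomorphism

Classical bookkeeping complementing `PlacesOfRingEquiv.lean` (J. W. S. Cassels, A. Fröhlich (eds.),
*Algebraic Number Theory* (1967), Ch. VII (J. Tate) §1.1: conjugate primes / places have the same local
invariants). The absolute norm of an ideal is preserved by a ring isomorphism (the tree's
`Literature.NumberTheory.NumberFields.absNorm_map_ringEquiv`, `ArithmeticEquivalence.lean`, imported — not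
restated); in particular `N(σ𝔭) = N(𝔭)` for the primes of the rings of integers of isomorphic number fields
`σ : K ≃+* K'`; and the multiplicity `[K_w : ℝ] ∈ {1, 2}` of an archimedean place is preserved under
`w ↦ w ∘ σ⁻¹`. PROVED, Mathlib-level; proof-only (no definitions). Consumer: the degree / log-volume
invariance of the model global Frobenioid objects of [IUTchIII] §3 under Kummer isomorphisms of number
fields (`Literature/IUT/LogThetaLattice/GlobalFrobenioidModelsTransport*.lean`).
-/

namespace Literature.NumberTheory.NumberFields

open NumberField

/-- **`N(σ𝔭) = N(𝔭)`** for an ideal `𝔭` of `𝓞 K` and its image under the isomorphism `𝓞 K ≃+* 𝓞 K'` induced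
by `σ : K ≃+* K'` (conjugate primes of isomorphic number fields have the same absolute norm).
[cite: CasselsFrohlichANT1967, Ch. VII §1.1] -/
theorem absNorm_map_mapRingEquiv {K K' : Type*} [Field K] [NumberField K] [Field K'] [NumberField K']
    (σ : K ≃+* K') (I : Ideal (𝓞 K)) :
    Ideal.absNorm (Ideal.map (RingOfIntegers.mapRingEquiv σ : 𝓞 K →+* 𝓞 K') I) = Ideal.absNorm I :=
  absNorm_map_ringEquiv (RingOfIntegers.mapRingEquiv σ) I

/-- **Real places correspond to real places** under `w ↦ w ∘ σ⁻¹` for `σ : K ≃+* K'` (Mathlib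
`isReal_comap_iff`). [cite: CasselsFrohlichANT1967, Ch. VII §1.1] -/
theorem isReal_comap_symm_iff {K K' : Type*} [Field K] [Field K'] (σ : K ≃+* K') (w : InfinitePlace K) :
    (w.comap (σ.symm : K' →+* K)).IsReal ↔ w.IsReal :=
  InfinitePlace.isReal_comap_iff σ.symm

/-- **The multiplicity `[K_w : ℝ]` of an archimedean place is preserved**: `mult (w ∘ σ⁻¹) = mult w` for
`σ : K ≃+* K'`. [cite: CasselsFrohlichANT1967, Ch. VII §1.1] -/
theorem mult_comap_symm {K K' : Type*} [Field K] [Field K'] (σ : K ≃+* K') (w : InfinitePlace K) :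
    (w.comap (σ.symm : K' →+* K)).mult = w.mult := by
  by_cases h : w.IsReal
  · rw [InfinitePlace.mult, InfinitePlace.mult, if_pos h, if_pos ((isReal_comap_symm_iff σ w).mpr h)]
  · rw [InfinitePlace.mult, InfinitePlace.mult, if_neg h, if_neg (mt (isReal_comap_symm_iff σ w).mp h)]

/-- The multiplicity is preserved under `w' ↦ w' ∘ σ` as well (`σ : K ≃+* K'`, `w'` a place of `K'`).
[cite: CasselsFrohlichANT1967, Ch. VII §1.1] -/
theorem mult_comap_ringEquiv {K K' : Type*} [Field K] [Field K'] (σ : K ≃+* K') (w' : InfinitePlace K') :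
    (w'.comap (σ : K →+* K')).mult = w'.mult := by
  by_cases h : w'.IsReal
  · rw [InfinitePlace.mult, InfinitePlace.mult, if_pos h,
      if_pos ((InfinitePlace.isReal_comap_iff σ).mpr h)]
  · rw [InfinitePlace.mult, InfinitePlace.mult, if_neg h,
      if_neg (mt (InfinitePlace.isReal_comap_iff σ).mp h)]

end Literature.NumberTheory.NumberFields
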